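import Summits.SmoothPoincare4.SmoothPoincare4.Theorems.SblfDescentRungOneDefs
import Summits.SmoothPoincare4.SmoothPoincare4.Theorems.SblfDescentRungOneHelperDxHeight
import Literature.Geometry.Manifold.SmoothEmbeddingInverse
import HarnessLib

/-!
# Disc extension, layer 2: one torus fibre in rigid coordinates, and the comparison maps

Auxiliary file of helper `helper_sliceGluing_discExtension` (apex leaf DX: extension of the
torus angular coordinate over the torus disc), line `Sketch`, crux `SblfDescent.RungOne`.

(Crux item stmt-SmoothPoincare4-18531; skeleton `Cruxes/RungOne/Lines/Sketch.lean`.)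

Setting: the torus side `ιT : Fb × ℝ² ↪ X` of the fibration (`IsTorusSideProduct f v ιT`) and
rigid torus coordinates `(aC, bC) : band fibres ≅ 𝕊¹ × 𝕊¹`, `ιC` their inverse
(`IsRigidCollar f v ν σ g s₁ s₂ ε₂ ιC aC bC`) on the band `{s₁ < h < s₂}` of the height
`h = v₂ f₂` (`hgt`).  For a base point `w` of the band annulus (`w ≠ 0`, `s₁ < sT w < s₂`):

* `ΨT ιT aC bC w : Fb → 𝕊¹ × 𝕊¹`, `θ ↦ (aC, bC) (ιT (θ, w))`, and its inverse
  `ΦT v ιT ιC w : 𝕊¹ × 𝕊¹ → Fb`, `(a, b) ↦ pr₁ (ιT⁻¹ (ιC ((a, b), (uT v w, sT w))))`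
  (`ΦT_ΨT`, `ΨT_ΦT`): every band fibre is a torus, smoothly (`contMDiffOn_ΨT`,
  `contMDiff_ΦT`, and `contMDiff_ΦT_circle`: jointly smooth along base circles);
* hence `θ ↦ ΨT w θ` has surjective differential (`surjective_mfderiv_ΨT`).

Everything is folklore differential topology (Lee 2013, Prop. 4.22 for the inverse of the
embedding `ιT`, via `Literature.Geometry.Manifold.contMDiffOn_invFun_range`).
-/

set_option linter.dupNamespace false

noncomputable section

open scoped Manifold ContDiff Topology Real RealInnerProductSpace
open Set Function Metric Literature.Topology.FourManifolds

namespace Summit.SmoothPoincare4.SmoothPoincare4.Cruxes.RungOne.Sketch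

namespace DiscExt

/-- Local notation: `𝔼 n` is the model Euclidean space `EuclideanSpace ℝ (Fin n)`. -/
local notation "𝔼 " n:arg => EuclideanSpace ℝ (Fin n)

/-- Local notation: `𝕊¹`, the unit circle of `ℝ²`. -/
local notation "𝕊¹" => (Metric.sphere (0 : EuclideanSpace ℝ (Fin 2)) (1 : ℝ))

/-- Local notation: `𝕊²`, the unit sphere of `ℝ³`. -/
local notation "𝕊²" => (Metric.sphere (0 : EuclideanSpace ℝ (Fin 3)) (1 : ℝ))

attribute [local instance] Literature.Topology.FourManifolds.fact_finrank_euclideanSpace_succ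

/-! ### Surjective differentials from two-sided smooth inverses -/

section Inverse

variable {EM : Type*} [NormedAddCommGroup EM] [NormedSpace ℝ EM] {HM : Type*} [TopologicalSpace HM]
  {I : ModelWithCorners ℝ EM HM} {M : Type*} [TopologicalSpace M] [ChartedSpace HM M]
  {EN : Type*} [NormedAddCommGroup EN] [NormedSpace ℝ EN] {HN : Type*} [TopologicalSpace HN]
  {J : ModelWithCorners ℝ EN HN} {N : Type*} [TopologicalSpace N] [ChartedSpace HN N]

/-- **A smooth map with a smooth two-sided inverse has surjective differential.** [folklore] -/
theorem surjective_mfderiv_of_inverse {F : M → N} {G : N → M} {x : M}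
    (hF : ContMDiffAt I J ∞ F x) (hG : ContMDiffAt J I ∞ G (F x))
    (hGF : G (F x) = x) (hFG : ∀ y, F (G y) = y) : Surjective (mfderiv I J F x) := by
  have hFd : MDifferentiableAt I J F x := hF.mdifferentiableAt (by simp)
  have hGd : MDifferentiableAt J I G (F x) := hG.mdifferentiableAt (by simp)
  have hcomp : F ∘ G = id := funext hFG
  have hFd' : MDifferentiableAt I J F (G (F x)) := by rw [hGF]; exact hFd
  have hchain : mfderiv J J (F ∘ G) (F x) = (mfderiv I J F (G (F x))).comp (mfderiv J I G (F x)) :=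
    mfderiv_comp (F x) hFd' hGd
  rw [hcomp, mfderiv_id, hGF] at hchain
  intro z
  exact ⟨mfderiv J I G (F x) z, (DFunLike.congr_fun hchain z).symm⟩

/-- **A smooth map with a smooth two-sided inverse has injective differential.** [folklore] -/
theorem injective_mfderiv_of_inverse {F : M → N} {G : N → M} {x : M}
    (hF : ContMDiffAt I J ∞ F x) (hG : ContMDiffAt J I ∞ G (F x))
    (hGF : ∀ x', G (F x') = x') : Injective (mfderiv I J F x) := by
  have hFd : MDifferentiableAt I J F x := hF.mdifferentiableAt (by simp)
  have hGd : MDifferentiableAt J I G (F x) := hG.mdifferentiableAt (by simp)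
  have hcomp : G ∘ F = id := funext hGF
  have hchain : mfderiv I I (G ∘ F) x = (mfderiv J I G (F x)).comp (mfderiv I J F x) :=
    mfderiv_comp x hGd hFd
  rw [hcomp, mfderiv_id] at hchain
  intro z z' h
  have e1 : z = mfderiv J I G (F x) (mfderiv I J F x z) := DFunLike.congr_fun hchain z
  have e2 : z' = mfderiv J I G (F x) (mfderiv I J F x z') := DFunLike.congr_fun hchain z'
  rw [e1, e2, h]

end Inverse

/-! ### The height and the torus side -/

/-- **The height** `h(x) = v₂ · (f x)₂` (`= ⟪f x, v⟫` for a pole with `v₀ = v₁ = 0`), the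
function whose bands carry the collar coordinates. [folklore] -/
def hgt {X : Type} (f : X → 𝕊²) (v : 𝕊²) (x : X) : ℝ := (v : 𝔼 3) 2 * ((f x : 𝕊²) : 𝔼 3) 2

/-- Unfolding `hgt`. [folklore] -/
theorem hgt_apply {X : Type} (f : X → 𝕊²) (v : 𝕊²) (x : X) :
    hgt f v x = (v : 𝔼 3) 2 * ((f x : 𝕊²) : 𝔼 3) 2 := rfl

section Setup

variable {X : Type} [TopologicalSpace X] [ChartedSpace (𝔼 4) X]
  {Fb : Type} [TopologicalSpace Fb] [ChartedSpace (𝔼 2) Fb]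
  {f : X → 𝕊²} {v : 𝕊²} {ιT : Fb × 𝔼 2 → X}
  {ν : 𝕊¹ × 𝔼 3 → X} {σ : ℝ} {g : ℝ → ℝ} {s₁ s₂ ε₂ : ℝ}
  {ιC : (𝕊¹ × 𝕊¹) × (𝕊¹ × ℝ) → X} {aC bC : X → 𝕊¹}

/-- **The height along the torus side** is `sT w = 1/(1 + 2‖w‖²)`. [folklore] -/
theorem hgt_ιT (hT : IsTorusSideProduct f v ιT) (hv0 : (v : 𝔼 3) 0 = 0) (hv1 : (v : 𝔼 3) 1 = 0)
    (θ : Fb) (w : 𝔼 2) : hgt f v (ιT (θ, w)) = sT w := by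
  rw [hgt, hT.formula (θ, w)]
  exact height_yT hv0 hv1 w

/-- `f ∘ ιT` is the base point map `yT v`. [folklore] -/
theorem f_ιT (hT : IsTorusSideProduct f v ιT) (θ : Fb) (w : 𝔼 2) : f (ιT (θ, w)) = yT v w :=
  hT.formula (θ, w)

/-- **The torus side is the positive-height region.** [folklore] -/
theorem mem_range_ιT_iff (hT : IsTorusSideProduct f v ιT) (hv0 : (v : 𝔼 3) 0 = 0)
    (hv1 : (v : 𝔼 3) 1 = 0) {x : X} : x ∈ range ιT ↔ 0 < hgt f v x := by
  rw [hT.range_eq, mem_preimage, mem_setOf_eq, coe_neg_sphere, inner_neg_right, inner_pole hv0 hv1,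
    neg_lt_zero, hgt]

/-- `ιT` is injective. [folklore] -/
theorem ιT_injective (hT : IsTorusSideProduct f v ιT) : Injective ιT :=
  hT.isSmoothEmbedding.isEmbedding.injective

/-- The base coordinate of `ιT⁻¹ x` is read off from `f x`. [folklore] -/
theorem invFun_ιT_snd [Nonempty Fb] (hT : IsTorusSideProduct f v ιT) {x : X} (hx : x ∈ range ιT)
    {w : 𝔼 2} (hfx : f x = yT v w) : (invFun ιT x).2 = w := by
  apply yT_injective v
  rw [← hfx]
  conv_rhs => rw [← Function.invFun_eq hx]
  exact (f_ιT hT _ _).symm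

/-- **The height in collar coordinates** is the coordinate `s`. [folklore] -/
theorem hgt_ιC (hC : IsRigidCollar f v ν σ g s₁ s₂ ε₂ ιC aC bC) (hv0 : (v : 𝔼 3) 0 = 0)
    (hv1 : (v : 𝔼 3) 1 = 0) (a b u : 𝕊¹) {s : ℝ} (h1 : s₁ < s) (h2 : s < s₂) :
    hgt f v (ιC ((a, b), (u, s))) = s := by
  rw [hgt, (hC.formula a b u s h1 h2).2.2.1, ← mul_assoc, pole_mul_self hv0 hv1, one_mul]

/-- **The collar point over `w`**: `f (ιC ((a, b), (uT v w, sT w))) = yT v w`. [folklore] -/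
theorem f_ιC_uT (hC : IsRigidCollar f v ν σ g s₁ s₂ ε₂ ιC aC bC) (hv0 : (v : 𝔼 3) 0 = 0)
    (hv1 : (v : 𝔼 3) 1 = 0) {w : 𝔼 2} (hw : w ≠ 0) (h1 : s₁ < sT w) (h2 : sT w < s₂)
    (ab : 𝕊¹ × 𝕊¹) : f (ιC (ab, (uT v w, sT w))) = yT v w := by
  obtain ⟨e0, e1, e2, -, -⟩ := hC.formula ab.1 ab.2 (uT v w) (sT w) h1 h2
  exact eq_yT_of_coords hv0 hv1 hw e0 e1 e2

/-- The collar point over `w` lies in the torus side. [folklore] -/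
theorem ιC_mem_range (hT : IsTorusSideProduct f v ιT) (hC : IsRigidCollar f v ν σ g s₁ s₂ ε₂ ιC aC bC)
    (hv0 : (v : 𝔼 3) 0 = 0) (hv1 : (v : 𝔼 3) 1 = 0) {w : 𝔼 2} (h1 : s₁ < sT w) (h2 : sT w < s₂)
    (ab : 𝕊¹ × 𝕊¹) : ιC (ab, (uT v w, sT w)) ∈ range ιT := by
  rw [mem_range_ιT_iff hT hv0 hv1, show ab = (ab.1, ab.2) from rfl, hgt_ιC hC hv0 hv1 _ _ _ h1 h2]
  exact sT_pos w

/-! ### One band fibre in rigid coordinates -/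

variable (ιT aC bC) in
/-- **Rigid coordinates of the fibre over `w`**: `ΨT w θ = (aC, bC) (ιT (θ, w))`. [folklore] -/
def ΨT (w : 𝔼 2) (θ : Fb) : 𝕊¹ × 𝕊¹ := (aC (ιT (θ, w)), bC (ιT (θ, w)))

variable (v ιT ιC) in
/-- **The inverse coordinates**: `ΦT w (a, b) = pr₁ (ιT⁻¹ (ιC ((a, b), (uT v w, sT w))))`.
[folklore] -/
def ΦT [Nonempty Fb] (w : 𝔼 2) (ab : 𝕊¹ × 𝕊¹) : Fb := (invFun ιT (ιC (ab, (uT v w, sT w)))).1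

/-- The section identity of the collar, with the longitude pinned down: over `w`,
`ιC ((aC x, bC x), (uT v w, sT w)) = x` for `x = ιT (θ, w)`. [folklore] -/
theorem ιC_ΨT (hT : IsTorusSideProduct f v ιT) (hC : IsRigidCollar f v ν σ g s₁ s₂ ε₂ ιC aC bC)
    (hv0 : (v : 𝔼 3) 0 = 0) (hv1 : (v : 𝔼 3) 1 = 0) {w : 𝔼 2} (hw : w ≠ 0) (h1 : s₁ < sT w)
    (h2 : sT w < s₂) (θ : Fb) : ιC (ΨT ιT aC bC w θ, (uT v w, sT w)) = ιT (θ, w) := by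
  have hx1 : s₁ < hgt f v (ιT (θ, w)) := by rwa [hgt_ιT hT hv0 hv1]
  have hx2 : hgt f v (ιT (θ, w)) < s₂ := by rwa [hgt_ιT hT hv0 hv1]
  obtain ⟨u, hu⟩ := hC.section_eq (ιT (θ, w)) hx1 hx2
  rw [show (v : 𝔼 3) 2 * ((f (ιT (θ, w)) : 𝕊²) : 𝔼 3) 2 = hgt f v (ιT (θ, w)) from rfl,
    hgt_ιT hT hv0 hv1] at hu
  -- pin down `u = uT v w` by applying `f`
  obtain ⟨e0, e1, -, -, -⟩ := hC.formula (aC (ιT (θ, w))) (bC (ιT (θ, w))) u (sT w) h1 h2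
  rw [hu, f_ιT hT] at e0 e1
  have hu' : u = uT v w := eq_uT_of_coords hv0 hv1 hw e0.symm e1.symm
  rw [hu'] at hu
  exact hu

/-- **`ΦT ∘ ΨT = id`.** [folklore] -/
theorem ΦT_ΨT [Nonempty Fb] (hT : IsTorusSideProduct f v ιT)
    (hC : IsRigidCollar f v ν σ g s₁ s₂ ε₂ ιC aC bC) (hv0 : (v : 𝔼 3) 0 = 0) (hv1 : (v : 𝔼 3) 1 = 0)
    {w : 𝔼 2} (hw : w ≠ 0) (h1 : s₁ < sT w) (h2 : sT w < s₂) (θ : Fb) :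
    ΦT v ιT ιC w (ΨT ιT aC bC w θ) = θ := by
  rw [ΦT, ιC_ΨT hT hC hv0 hv1 hw h1 h2, Function.leftInverse_invFun (ιT_injective hT)]

/-- **`ΨT ∘ ΦT = id`.** [folklore] -/
theorem ΨT_ΦT [Nonempty Fb] (hT : IsTorusSideProduct f v ιT)
    (hC : IsRigidCollar f v ν σ g s₁ s₂ ε₂ ιC aC bC) (hv0 : (v : 𝔼 3) 0 = 0) (hv1 : (v : 𝔼 3) 1 = 0)
    {w : 𝔼 2} (hw : w ≠ 0) (h1 : s₁ < sT w) (h2 : sT w < s₂) (ab : 𝕊¹ × 𝕊¹) :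
    ΨT ιT aC bC w (ΦT v ιT ιC w ab) = ab := by
  set x' := ιC (ab, (uT v w, sT w)) with hx'
  have hmem : x' ∈ range ιT := ιC_mem_range hT hC hv0 hv1 h1 h2 ab
  have hq2 : (invFun ιT x').2 = w := invFun_ιT_snd hT hmem (f_ιC_uT hC hv0 hv1 hw h1 h2 ab)
  have hq : ιT ((invFun ιT x').1, w) = x' := by
    conv_lhs => rw [← hq2]
    exact Function.invFun_eq hmem
  obtain ⟨-, -, -, ea, eb⟩ := hC.formula ab.1 ab.2 (uT v w) (sT w) h1 h2
  rw [ΨT, ΦT, hq, hx']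
  exact Prod.ext ea eb

/-! ### Smoothness -/

/-- The band annulus `{s₁ < sT < s₂}` of the base is open. [folklore] -/
theorem isOpen_annulus (s₁ s₂ : ℝ) : IsOpen {w : 𝔼 2 | s₁ < sT w ∧ sT w < s₂} :=
  (isOpen_Ioo (a := s₁) (b := s₂)).preimage contDiff_sT.continuous

/-- **`(θ, w) ↦ ΨT w θ` is smooth over the band annulus.** [folklore] -/
theorem contMDiffOn_ΨT (hT : IsTorusSideProduct f v ιT) (hC : IsRigidCollar f v ν σ g s₁ s₂ ε₂ ιC aC bC)
    (hv0 : (v : 𝔼 3) 0 = 0) (hv1 : (v : 𝔼 3) 1 = 0) :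
    ContMDiffOn ((𝓡 2).prod (𝓡 2)) ((𝓡 1).prod (𝓡 1)) ∞ (fun q : Fb × 𝔼 2 ↦ ΨT ιT aC bC q.2 q.1)
      (univ ×ˢ {w : 𝔼 2 | s₁ < sT w ∧ sT w < s₂}) := by
  have hmaps : MapsTo ιT (univ ×ˢ {w : 𝔼 2 | s₁ < sT w ∧ sT w < s₂})
      {x | s₁ < (v : 𝔼 3) 2 * ((f x : 𝕊²) : 𝔼 3) 2 ∧ (v : 𝔼 3) 2 * ((f x : 𝕊²) : 𝔼 3) 2 < s₂} := by
    rintro ⟨θ, w⟩ ⟨-, hw⟩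
    change s₁ < hgt f v (ιT (θ, w)) ∧ hgt f v (ιT (θ, w)) < s₂
    rw [hgt_ιT hT hv0 hv1]
    exact hw
  have hι : ContMDiffOn ((𝓡 2).prod (𝓡 2)) (𝓡 4) ∞ ιT (univ ×ˢ {w : 𝔼 2 | s₁ < sT w ∧ sT w < s₂}) :=
    hT.isSmoothEmbedding.contMDiff.contMDiffOn
  exact (hC.contMDiffOn_aC.comp hι hmaps).prodMk (hC.contMDiffOn_bC.comp hι hmaps)

/-- **`θ ↦ ΨT w θ` is smooth** for `w` in the band annulus. [folklore] -/
theorem contMDiff_ΨT (hT : IsTorusSideProduct f v ιT) (hC : IsRigidCollar f v ν σ g s₁ s₂ ε₂ ιC aC bC)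
    (hv0 : (v : 𝔼 3) 0 = 0) (hv1 : (v : 𝔼 3) 1 = 0) {w : 𝔼 2} (h1 : s₁ < sT w) (h2 : sT w < s₂) :
    ContMDiff (𝓡 2) ((𝓡 1).prod (𝓡 1)) ∞ (ΨT ιT aC bC w) :=
  (contMDiffOn_ΨT hT hC hv0 hv1).comp_contMDiff (f := fun θ : Fb ↦ (θ, w))
    (contMDiff_id.prodMk contMDiff_const) fun _ ↦ ⟨mem_univ _, h1, h2⟩

/-- **`ΦT w` is smooth** for `w ≠ 0` in the band annulus. [folklore] -/
theorem contMDiff_ΦT [Nonempty Fb] (hT : IsTorusSideProduct f v ιT)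
    (hC : IsRigidCollar f v ν σ g s₁ s₂ ε₂ ιC aC bC) (hv0 : (v : 𝔼 3) 0 = 0) (hv1 : (v : 𝔼 3) 1 = 0)
    {w : 𝔼 2} (h1 : s₁ < sT w) (h2 : sT w < s₂) :
    ContMDiff ((𝓡 1).prod (𝓡 1)) (𝓡 2) ∞ (ΦT v ιT ιC w) := by
  haveI : Nonempty (Fb × 𝔼 2) := inferInstance
  have h1' : ContMDiff ((𝓡 1).prod (𝓡 1)) (𝓡 4) ∞ fun ab : 𝕊¹ × 𝕊¹ ↦ ιC (ab, (uT v w, sT w)) :=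
    hC.contMDiffOn.comp_contMDiff (f := fun ab : 𝕊¹ × 𝕊¹ ↦ (ab, (uT v w, sT w)))
      (contMDiff_id.prodMk contMDiff_const) fun ab ↦ ⟨mem_univ _, mem_univ _, h1, h2⟩
  have h2' : ContMDiff ((𝓡 1).prod (𝓡 1)) ((𝓡 2).prod (𝓡 2)) ∞
      fun ab : 𝕊¹ × 𝕊¹ ↦ invFun ιT (ιC (ab, (uT v w, sT w))) :=
    (Literature.Geometry.Manifold.contMDiffOn_invFun_range hT.isSmoothEmbedding).comp_contMDiff h1'
      fun ab ↦ ιC_mem_range hT hC hv0 hv1 h1 h2 ab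
  exact contMDiff_fst.comp h2'

/-- **`ΦT` is jointly smooth along base circles**: `(t, ab) ↦ ΦT (R • circlePt t) ab` is `C^∞`
when the circle of radius `R > 0` lies in the band annulus. [folklore] -/
theorem contMDiff_ΦT_circle [Nonempty Fb] (hT : IsTorusSideProduct f v ιT)
    (hC : IsRigidCollar f v ν σ g s₁ s₂ ε₂ ιC aC bC) (hv0 : (v : 𝔼 3) 0 = 0) (hv1 : (v : 𝔼 3) 1 = 0)
    {R : ℝ} (hR : 0 < R) (h1 : s₁ < (1 + 2 * R ^ 2)⁻¹) (h2 : (1 + 2 * R ^ 2)⁻¹ < s₂) :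
    ContMDiff (𝓘(ℝ, ℝ).prod ((𝓡 1).prod (𝓡 1))) (𝓡 2) ∞
      fun q : ℝ × (𝕊¹ × 𝕊¹) ↦ ΦT v ιT ιC (R • ((circlePt q.1 : 𝕊¹) : 𝔼 2)) q.2 := by
  haveI : Nonempty (Fb × 𝔼 2) := inferInstance
  have hs : ∀ t, sT (R • ((circlePt t : 𝕊¹) : 𝔼 2)) = (1 + 2 * R ^ 2)⁻¹ := sT_smul_circlePt R
  have hin : ContMDiff (𝓘(ℝ, ℝ).prod ((𝓡 1).prod (𝓡 1))) (((𝓡 1).prod (𝓡 1)).prod ((𝓡 1).prod 𝓘(ℝ, ℝ))) ∞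
      fun q : ℝ × (𝕊¹ × 𝕊¹) ↦ ((q.2, (uT v (R • ((circlePt q.1 : 𝕊¹) : 𝔼 2)), (1 + 2 * R ^ 2)⁻¹)) :
        (𝕊¹ × 𝕊¹) × (𝕊¹ × ℝ)) :=
    contMDiff_snd.prodMk (((contMDiff_uT_circle hv0 hv1 hR).comp contMDiff_fst).prodMk contMDiff_const)
  have h1' : ContMDiff (𝓘(ℝ, ℝ).prod ((𝓡 1).prod (𝓡 1))) (𝓡 4) ∞
      fun q : ℝ × (𝕊¹ × 𝕊¹) ↦ ιC (q.2, (uT v (R • ((circlePt q.1 : 𝕊¹) : 𝔼 2)), (1 + 2 * R ^ 2)⁻¹)) :=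
    hC.contMDiffOn.comp_contMDiff hin fun q ↦ ⟨mem_univ _, mem_univ _, h1, h2⟩
  have h2' : ContMDiff (𝓘(ℝ, ℝ).prod ((𝓡 1).prod (𝓡 1))) ((𝓡 2).prod (𝓡 2)) ∞
      fun q : ℝ × (𝕊¹ × 𝕊¹) ↦ invFun ιT (ιC (q.2, (uT v (R • ((circlePt q.1 : 𝕊¹) : 𝔼 2)), (1 + 2 * R ^ 2)⁻¹))) := by
    refine (Literature.Geometry.Manifold.contMDiffOn_invFun_range hT.isSmoothEmbedding).comp_contMDiff h1'
      fun q ↦ ?_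
    have := ιC_mem_range hT hC hv0 hv1 (w := R • ((circlePt q.1 : 𝕊¹) : 𝔼 2)) (by rw [hs]; exact h1)
      (by rw [hs]; exact h2) q.2
    rwa [hs] at this
  have h3 : (fun q : ℝ × (𝕊¹ × 𝕊¹) ↦ ΦT v ιT ιC (R • ((circlePt q.1 : 𝕊¹) : 𝔼 2)) q.2) =
      fun q ↦ (invFun ιT (ιC (q.2, (uT v (R • ((circlePt q.1 : 𝕊¹) : 𝔼 2)), (1 + 2 * R ^ 2)⁻¹)))).1 := by
    funext q; rw [ΦT, hs]
  rw [h3]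
  exact contMDiff_fst.comp h2'

/-- **The fibre coordinates have surjective differential**: for `w ≠ 0` in the band annulus,
`θ ↦ ΨT w θ` is a diffeomorphism `Fb ≅ 𝕊¹ × 𝕊¹`, so its differential is onto. [folklore] -/
theorem surjective_mfderiv_ΨT [Nonempty Fb] [IsManifold (𝓡 2) ∞ Fb] (hT : IsTorusSideProduct f v ιT)
    (hC : IsRigidCollar f v ν σ g s₁ s₂ ε₂ ιC aC bC) (hv0 : (v : 𝔼 3) 0 = 0) (hv1 : (v : 𝔼 3) 1 = 0)
    {w : 𝔼 2} (hw : w ≠ 0) (h1 : s₁ < sT w) (h2 : sT w < s₂) (θ : Fb) :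
    Surjective (mfderiv (𝓡 2) ((𝓡 1).prod (𝓡 1)) (ΨT ιT aC bC w) θ) :=
  surjective_mfderiv_of_inverse (contMDiff_ΨT hT hC hv0 hv1 h1 h2).contMDiffAt
    (contMDiff_ΦT hT hC hv0 hv1 h1 h2).contMDiffAt (ΦT_ΨT hT hC hv0 hv1 hw h1 h2 θ)
    (ΨT_ΦT hT hC hv0 hv1 hw h1 h2)

end Setup

end DiscExt

end Summit.SmoothPoincare4.SmoothPoincare4.Cruxes.RungOne.Sketch

end
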